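import Summits.BirchSwinnertonDyer.BirchSwinnertonDyer.Theorems.ManinLocalTwoThreeManinOfStevensConjectures
import Summits.BirchSwinnertonDyer.BirchSwinnertonDyer.Theorems.ManinLocalTwoThreeShimuraKernelBlindNecessary
import Summits.BirchSwinnertonDyer.BirchSwinnertonDyer.Theorems.ManinLocalTwoThreeShimuraDefectLawAtThree
import HarnessLib

/-!
# Stevens' Conjecture II ⟹ E-an-152: the index-`2` Shimura kernel point of a class whose Stevens curve is minimal is Kummer-BLIND

Summit `BirchSwinnertonDyer`, route `ManinLocalTwoThree` (cell bsd-f2-manin), crux C2 `ManinOddAtFour` (stmt-BirchSwinnertonDyer-22967);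
lead p1 gen 14.  an's MEMO-an §78.11 claimed «E-an-152 ⟸ Stevens' conjecture (E₁ = E_min)» on paper; the kernel-checked form is:
for the optimal pair `(D₁, D₀)` of a class at `4 ∣ N` (`W₀ = [0, a₂, 0, a₄, a₆]`), if the Stevens curve `W₁` has maximal Néron covolume
in its class (`KatoCurve.IsMaxCovolumeInClass W₁` — Stevens 1989, Conjecture II with Thm. 2.3), then at every `w ∈ Λ₁(f) ∖ 2Λ₀(f)` (so the
Shimura index is `2`, not `4`) the kernel point `℘(c₀w/2)` is a rational, integral, Kummer-BLIND `2`-torsion point: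
`|c₀| = |c₁|` by `natAbs_maninConstant₀_eq_of_maxCovolume_of_index_ne_four` (index `4` is excluded by `w` itself), then
`shimuraKernelBlindAt_of_natAbs_eq` (p713937).  Universally: `shimuraKernelBlindAtFour_of_maxCovolume` — **F-need ∧ Stevens II ⟹ E-an-152**
(no index-`4` law needed: E-an-152 is vacuous there).  The `3`-adic twin: Stevens II ⟹ untripled index-`3` kernel lines ascend
(`velu_three_ascends_at_of_maxCovolume`).

HONEST FRAMING: CONDITIONAL on Stevens' Conjecture II (OPEN; carried as the hypothesis `IsMaxCovolumeInClass`, nothing asserted); E-an-152 stays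
an OPEN law unconditionally; BSD is not proved; C2/C3 OPEN.  No definitions, no named facts, no sorry.
-/

set_option autoImplicit false
-- the summit-side namespace `Summit.BirchSwinnertonDyer.BirchSwinnertonDyer.…` is the tree's (summit = sub-problem)
set_option linter.dupNamespace false

noncomputable section

open scoped Classical
open WeierstrassCurve Literature.NumberTheory.EllipticCurves Literature.NumberTheory.EllipticCurves.ModularForms
open CongruenceSubgroup
open Summit.BirchSwinnertonDyer.Rank1Residual.ManinAdditive.ShimuraKernel
open Summit.BirchSwinnertonDyer.Rank1Residual.ManinAdditive.KatoCurve
open Summit.BirchSwinnertonDyer.Rank1Residual.ManinAdditive.CuspidalKummer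

namespace Summit.BirchSwinnertonDyer.BirchSwinnertonDyer.Theorems.ManinLocalTwoThree

variable {W₁ W₀ : WeierstrassCurve ℚ} [W₁.IsElliptic] [W₁.IsGloballyMinimal] [W₀.IsElliptic]
  [W₀.IsGloballyMinimal] {N : ℕ} [NeZero N]

/-- **Stevens II at the class ⟹ the index-`2` kernel point is BLIND.**  For the optimal `X₁(N)`-datum `D₁` of `W₁` and a lattice-optimal
`X₀(N)`-datum `D₀` of an isogenous `W₀ = [0, a₂, 0, a₄, a₆]`, `4 ∣ N`, `IsMaxCovolumeInClass W₁`, `Λ₁(f) ≠ Λ₀(f)`, `w ∈ Λ₁(f) ∖ 2Λ₀(f)`: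
the kernel point `℘(c₀w/2)` is `E + a₂/3` for an integral root `E` with `KummerBlindAtTwo a₂ a₄ E`. [cite: Stevens1989, Conjecture II and Thm. 2.3 (hypothesis; nothing asserted)] -/
theorem shimuraKernelBlindAt_of_maxCovolume (D₁ : Gamma1ParametrizationData W₁ N) (D₀ : ModularParametrizationData W₀ N)
    (hiso : IsIsogenous W₁ W₀) (h₁ : D₁.IsOptimal)
    (h₀ : ∀ z ∈ D₀.L.lattice, ∃ w ∈ periodLattice D₀.f, z = D₀.c * w) (h4 : 2 ^ 2 ∣ N)
    (ha₁ : W₀.a₁ = 0) (ha₃ : W₀.a₃ = 0) (hmax : IsMaxCovolumeInClass W₁)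
    (hΛne : periodLatticeGamma1 D₀.f ≠ periodLattice D₀.f)
    {w : ℂ} (hw : w ∈ periodLatticeGamma1 D₀.f) (hw2 : ∀ v ∈ periodLattice D₀.f, w ≠ 2 * v) :
    ∃ A₂ A₄ E : ℤ, (A₂ : ℚ) = W₀.a₂ ∧ (A₄ : ℚ) = W₀.a₄ ∧
      (E : ℚ) ^ 3 + W₀.a₂ * (E : ℚ) ^ 2 + W₀.a₄ * E + W₀.a₆ = 0 ∧
      D₀.L.weierstrassP ((D₀.c : ℂ) * w / 2) = (((E : ℚ) + W₀.a₂ / 3 : ℚ) : ℂ) ∧ KummerBlindAtTwo A₂ A₄ E := by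
  have hne4 : ¬ (∀ z : ℂ, z ∈ periodLatticeGamma1 D₀.f ↔ ∃ v ∈ periodLattice D₀.f, z = 2 * v) :=
    fun hidx ↦ by obtain ⟨v, hv, hv'⟩ := (hidx w).mp hw; exact hw2 v hv hv'
  exact shimuraKernelBlindAt_of_natAbs_eq D₁ D₀ hiso h₁ h₀ h4 ha₁ ha₃
    (natAbs_maninConstant₀_eq_of_maxCovolume_of_index_ne_four D₁ D₀ hiso h₁ h₀ h4 hmax hne4) hΛne hw hw2

omit [W₁.IsElliptic] [W₁.IsGloballyMinimal] [W₀.IsElliptic] [W₀.IsGloballyMinimal] [NeZero N] in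
/-- **F-need ∧ Stevens II ⟹ E-an-152 `ShimuraKernelBlindAtFour`** (an's MEMO-an §78.11 claim, kernel-checked; no index-`4` law is needed since
E-an-152's witness `w ∈ Λ₁ ∖ 2Λ₀` excludes index `4`). [cite: Stevens1989, Conjecture II] -/
theorem shimuraKernelBlindAtFour_of_maxCovolume (hex : exists_optimal_gamma1ParametrizationData)
    (hSt2 : ∀ (W₁ : WeierstrassCurve ℚ) [W₁.IsElliptic] [W₁.IsGloballyMinimal] {N : ℕ} [NeZero N]
      (D₁ : Gamma1ParametrizationData W₁ N), D₁.IsOptimal → 2 ^ 2 ∣ N → IsMaxCovolumeInClass W₁) :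
    ShimuraKernelBlindAtFour := by
  intro W₀ _ _ N _ D₀ h₀ h4 ha₁ ha₃ hΛne w hw hw2
  obtain ⟨W₁, _, _, D₁, hiso, h₁⟩ := hex W₀ D₀ h₀
  exact shimuraKernelBlindAt_of_maxCovolume D₁ D₀ hiso h₁ h₀ h4 ha₁ ha₃ (hSt2 W₁ D₁ h₁ h4) hΛne hw hw2

/-- **The `3`-adic twin: Stevens II at the class ⟹ an index-`3` kernel line's Vélu `3`-quotient ASCENDS** (untripling is forced unless
index `9`, which `w ∈ Λ₁ ∖ 3Λ₀` excludes; then `velu_three_ascends_at_of_natAbs_eq`). [cite: Stevens1989, Conjecture II] -/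
theorem velu_three_ascends_at_of_maxCovolume (D₁ : Gamma1ParametrizationData W₁ N) (D₀ : ModularParametrizationData W₀ N)
    (hiso : IsIsogenous W₁ W₀) (h₁ : D₁.IsOptimal)
    (h₀ : ∀ z ∈ D₀.L.lattice, ∃ w ∈ periodLattice D₀.f, z = D₀.c * w) (h9 : 3 ^ 2 ∣ N)
    (hmax : IsMaxCovolumeInClass W₁) (hΛne : periodLatticeGamma1 D₀.f ≠ periodLattice D₀.f)
    {w : ℂ} (hw : w ∈ periodLatticeGamma1 D₀.f) (hw3 : ∀ v ∈ periodLattice D₀.f, w ≠ 3 * v) :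
    ∃ q : ℚ, (q : ℂ) = D₀.L.weierstrassP ((D₀.c : ℂ) * w / 3) ∧ W₀.Ψ₃.eval (q - W₀.b₂ / 12) = 0 ∧
      81 * W₁.c₄ = 1440 * q ^ 2 - 9 * W₀.c₄ ∧ 729 * W₁.c₆ = 60480 * q ^ 3 - 756 * W₀.c₄ * q - 27 * W₀.c₆ := by
  have hne9 : ¬ (∀ z : ℂ, z ∈ periodLatticeGamma1 D₀.f ↔ ∃ v ∈ periodLattice D₀.f, z = 3 * v) :=
    fun hidx ↦ by obtain ⟨v, hv, hv'⟩ := (hidx w).mp hw; exact hw3 v hv hv'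
  have heq : D₀.maninConstant.natAbs = D₁.maninConstant.natAbs := by
    rcases natAbs_maninConstant₀_eq_or_eq_three_mul_of_nine_dvd_level D₁ D₀ hiso h₁ h₀ h9 with h | h
    · exact h
    · exact absurd (index_nine_of_maxCovolume_of_natAbs_eq_three_mul D₁ D₀ hiso h₀ h9 hmax h) hne9
  exact velu_three_ascends_at_of_natAbs_eq D₁ D₀ hiso h₁ h₀ h9 heq hΛne hw hw3

end Summit.BirchSwinnertonDyer.BirchSwinnertonDyer.Theorems.ManinLocalTwoThree

end
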